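import Literature.AlgebraicTopology.CharacteristicClasses.CompletionThomClassVectorPart
import HarnessLib

/-!
# The top Chern number of a complex vector bundle is the sum of the local indices of a section

J. Milnor, J. Stasheff, *Characteristic Classes* (1974), §9–§12 (Thom class, Euler class, the
obstruction / index interpretation) and §14 ("the top Chern class `cₙ(ω)` is the Euler class
`e(ω_ℝ)`"); R. Bott, L. Tu, *Differential Forms in Algebraic Topology* (1982), Thm. 11.17 (the
Euler class is Poincaré dual to the zero locus of a section, the sum of the local degrees) with
Prop. 12.8 and §20–§21; D. McDuff, D. Salamon, *Introduction to Symplectic Topology*, 3rd ed.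
(2017), Thm. 2.7.5 (rank one) and Ex. 4.4.3 (v) ("`⟨c₂(TX), [X]⟩ … is the Euler characteristic",
computed from the zeros of a vector field); A. Hatcher, *Algebraic Topology* (2002), Lemma 3.27 /
Prop. 2.30 (a class of `Hₙ(M | K)`, `K` finite, is the sum of its local pieces).

For the tree's Chern classes of a bundled `ComplexVectorBundle` `E` of rank `k ≥ 1` and the Thom
class `t_E ∈ H²ᵏ(P(E ⊕ ℂ))` with its relative lift `t̃_E ∈ H²ᵏ(D, D ∖ s₀(B))`
(`CompletionThomClass`, `CompletionThomClassVectorPart`: `ŝ^* t_E = c_k(E)` for every section,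
`t_E|_{D ∖ s₀(B)} = 0`), this file proves the **localisation theorem** in every rank — the
rank-one case being `LineEulerNumberLocalization`, whose argument is repeated verbatim in degree
`2k`:

  `⟨c_k(E), [B]_μ⟩ = Σ_{p ∈ Z(s)} ind_p(s)`   (`kroneckerPairing_chernClass_fundamentalClass`)

for a closed `n`-manifold `B` (`n = 2k`, compact Hausdorff, charts `ℝⁿ`), any `R`-orientation
`μ` of `B`, and any continuous section `s` of `E` with finite zero set `Z(s)`; the LOCAL INDEX
`ind_p(s) ∈ R` (`localIndex`) is the relative Kronecker pairing `⟨(ŝ|_{U_p})^* t̃_E, μ_p⟩` on the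
index domain `U_p = {p} ∪ {s ≠ 0}` with the local orientation `μ_p` (excised to `U_p`), and is
local (`localIndex_eq_of_subset`: computable on any open `V ∋ p` inside `U_p`).

The identification of `ind_p(s)` with the local degree (`sign det` at a non-degenerate zero) and
the Poincaré–Hopf count `Σ ind_p = χ` for a vector field are the sequels towards
`⟨c_k(TM, J), [M]⟩ = χ(M)` (McDuff–Salamon Ex. 4.4.3 (v); Milnor–Stasheff Cor. 11.12).
Everything is proved; no named facts.

## References

* J. Milnor, J. Stasheff, *Characteristic Classes*, Ann. of Math. Stud. 76, PUP 1974, §9,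
  §10 Thm. 10.4, §12, §14. [MilnorStasheff1974]
* R. Bott, L. W. Tu, *Differential Forms in Algebraic Topology*, GTM 82, Springer 1982,
  Thm. 11.17, Prop. 12.8, §20–§21. [BottTu1982]
* D. McDuff, D. Salamon, *Introduction to Symplectic Topology*, 3rd ed., OUP 2017, Thm. 2.7.5,
  Ex. 4.4.3 (v). [McDuffSalamon2017]
* A. Hatcher, *Algebraic Topology*, CUP 2002, Prop. 2.30, Thm. 3.26, Lemma 3.27.
  [HatcherAT2002]
-/

noncomputable section

open CategoryTheory Function Set Bundle Topology unitInterval Literature.AlgebraicTopology.SingularHomology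
open scoped LinearAlgebra.Projectivization

namespace Literature.AlgebraicTopology.CharacteristicClasses

namespace ComplexVectorBundle

variable {B : Type} [TopologicalSpace B] (E : ComplexVectorBundle.{0, 0} B)

/-! ### Degree transport for relative classes -/

/-- Transport of relative cohomology classes along an equality of degrees (`2k = n`). [folklore] -/
def relDegCast (R : Type) [CommRing R] {X : Type} [TopologicalSpace X] {A : Set X} {a b : ℕ} (e : a = b) :
    relSingularCohomology R R X A a ≃ₗ[R] relSingularCohomology R R X A b := by
  subst e
  exact LinearEquiv.refl R _

/-- `relDegCast rfl = 𝟙`. [folklore] -/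
@[simp]
theorem relDegCast_rfl (R : Type) [CommRing R] {X : Type} [TopologicalSpace X] {A : Set X} {a : ℕ}
    (y : relSingularCohomology R R X A a) : relDegCast R (rfl : a = a) y = y := rfl

/-! ### The local index of a section at a zero -/

section LocalIndex

variable (s : ∀ b, E.E b) (hs : Continuous fun b ↦ (⟨b, s b⟩ : TotalSpace E.F E.E))
  [T2Space B] [ParacompactSpace B] (R : Type) [CommRing R] (hE : 0 < E.rank)

/-- **The local relative Thom class at `p`**: the pull-back `(ŝ|_{U_p})^* t̃_E ∈ H²ᵏ(U_p, U_p ∖ p; R)`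
of the relative Thom class along the projectivised section, on the index domain
`U_p = {p} ∪ {s ≠ 0}` (`indexDomain`). [cite: MilnorStasheff1974, §9 and §12] -/
def localComplThomPullback (p : B) :
    relSingularCohomology R R ↥(indexDomain s p) {(⟨p, mem_indexDomain_self s p⟩ : ↥(indexDomain s p))}ᶜ (2 * E.rank) :=
  relSingularCohomology.map R R ((E.complSection s hs).comp (subsetIncl (indexDomain s p)))
    (mapsTo_projSection_indexDomain s hs p) (2 * E.rank) (E.relComplThomClass R hE)

open Classical in
/-- **The local index `ind_p(s) ∈ R` of the section `s` at `p`** with respect to an `R`-orientation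
`μ` of the base in degree `n = 2k`: the relative Kronecker pairing of `(ŝ|_{U_p})^* t̃_E` with the
local orientation `μ_p` excised to the index domain `U_p` (McDuff–Salamon Thm. 2.7.5 / Ex. 4.4.3:
zeros "counted with multiplicity"; Bott–Tu Thm. 11.17: the local degree of the section).  Junk
value `0` when `U_p` is not open. [cite: BottTu1982, Thm. 11.17] [cite: McDuffSalamon2017, Thm. 2.7.5] -/
def localIndex {n : ℕ} (hn : 2 * E.rank = n) (μ : HomologicalOrientation R B n) (p : B) : R :=
  if h : IsOpen (indexDomain s p) then
    relKroneckerM R ↥(indexDomain s p) {(⟨p, mem_indexDomain_self s p⟩ : ↥(indexDomain s p))}ᶜ n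
      (relDegCast R hn (E.localComplThomPullback s hs R hE p))
      ((localHomology.openSubsetIso R R h (mem_indexDomain_self s p) n).inv (μ.localClass p))
  else 0

/-- The local index at an open index domain. [folklore] -/
theorem localIndex_of_isOpen {n : ℕ} (hn : 2 * E.rank = n) (μ : HomologicalOrientation R B n) (p : B)
    (h : IsOpen (indexDomain s p)) :
    E.localIndex s hs R hE hn μ p =
      relKroneckerM R ↥(indexDomain s p) {(⟨p, mem_indexDomain_self s p⟩ : ↥(indexDomain s p))}ᶜ n
        (relDegCast R hn (E.localComplThomPullback s hs R hE p))
        ((localHomology.openSubsetIso R R h (mem_indexDomain_self s p) n).inv (μ.localClass p)) := by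
  rw [localIndex, dif_pos h]

set_option maxHeartbeats 400000 in
/-- **The local index is local**: it may be computed on ANY open `V ∋ p` inside the index domain,
as the relative Kronecker pairing of `(ŝ|_V)^* t̃_E ∈ H²ᵏ(V, V ∖ p)` with the local orientation
excised to `V` (excision and naturality of the pairing). [cite: HatcherAT2002, Thm. 2.20] -/
theorem localIndex_eq_of_subset {n : ℕ} (hn : 2 * E.rank = n) (μ : HomologicalOrientation R B n) (p : B)
    (hU : IsOpen (indexDomain s p)) {V : Set B} (hV : IsOpen V) (hpV : p ∈ V) (hVU : V ⊆ indexDomain s p) :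
    E.localIndex s hs R hE hn μ p =
      relKroneckerM R ↥V ({(⟨p, hpV⟩ : ↥V)}ᶜ : Set ↥V) n
        (relDegCast R hn (relSingularCohomology.map R R ((E.complSection s hs).comp (subsetIncl V))
          (mapsTo_projSection_of_subset s hs hpV hVU) (2 * E.rank) (E.relComplThomClass R hE)))
        ((localHomology.openSubsetIso R R hV hpV n).inv (μ.localClass p)) := by
  subst hn
  rw [E.localIndex_of_isOpen s hs R hE rfl μ p hU, relDegCast_rfl, relDegCast_rfl]
  -- the inclusion of pairs `i : (V, V ∖ p) → (U_p, U_p ∖ p)`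
  set i : C(↥V, ↥(indexDomain s p)) := subsetInclusion hVU with hi
  have himaps : MapsTo i ({(⟨p, hpV⟩ : ↥V)}ᶜ : Set ↥V)
      ({(⟨p, mem_indexDomain_self s p⟩ : ↥(indexDomain s p))}ᶜ : Set ↥(indexDomain s p)) := by
    intro b hb hb'
    apply hb
    rw [mem_singleton_iff] at hb' ⊢
    exact Subtype.ext (congrArg (fun q : ↥(indexDomain s p) ↦ (q : B)) hb')
  -- homology side: `i_* (μ_p excised to V) = μ_p excised to U_p`
  have hhom : relativeSingularHomology.map R R i himaps (2 * E.rank)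
      ((localHomology.openSubsetIso R R hV hpV (2 * E.rank)).inv (μ.localClass p)) =
        (localHomology.openSubsetIso R R hU (mem_indexDomain_self s p) (2 * E.rank)).inv (μ.localClass p) := by
    rw [← Iso.hom_inv_id_apply (localHomology.openSubsetIso R R hU (mem_indexDomain_self s p) (2 * E.rank))
      (relativeSingularHomology.map R R i himaps (2 * E.rank) _)]
    congr 1
    change (relativeSingularHomology.map R R i himaps (2 * E.rank) ≫
      relativeSingularHomology.map R R (subsetIncl (indexDomain s p))
        (localHomology.mapsTo_subsetIncl_compl (mem_indexDomain_self s p)) (2 * E.rank)) _ = μ.localClass p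
    rw [← relativeSingularHomology.map_comp]
    exact Iso.inv_hom_id_apply (localHomology.openSubsetIso R R hV hpV (2 * E.rank)) (μ.localClass p)
  rw [← hhom, ← relKroneckerM_map, localComplThomPullback, ← ModuleCat.comp_apply, ← relSingularCohomology.map_comp]
  rfl

end LocalIndex

/-! ### The localisation theorem -/

section Main

variable (s : ∀ b, E.E b) (hs : Continuous fun b ↦ (⟨b, s b⟩ : TotalSpace E.F E.E))
  (R : Type) [CommRing R] (hE : 0 < E.rank)

/-- **Localisation of the top Chern number at the zeros of a section** (Bott–Tu 1982, Thm. 11.17;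
Milnor–Stasheff 1974, §9–§12 with §14; McDuff–Salamon 2017, Thm. 2.7.5 and Ex. 4.4.3 (v)): for a
complex vector bundle `E` of rank `k ≥ 1` over a closed `R`-oriented `2k`-manifold `B` and a
continuous section `s` with finitely many zeros,

  `⟨c_k(E), [B]_μ⟩ = Σ_{p ∈ Z(s)} ind_p(s)`.

Proof (as in rank one): `c_k(E) = ŝ^* t_E` (`map_complSection_complThomClass`); `t_E` lifts to
`t̃_E ∈ H²ᵏ(D, D ∖ s₀(B))` and `ŝ` maps `B ∖ Z` into `D ∖ s₀(B)`, so `c_k(E) = j^*(ŝ^* t̃_E)` with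
`ŝ^* t̃_E ∈ H²ᵏ(B, B ∖ Z)`; hence `⟨c_k(E), [B]⟩ = ⟨ŝ^* t̃_E, j_*[B]⟩` and `j_*[B] ∈ H_{2k}(B | Z)`
is the sum of the local orientations `μ_p`, `p ∈ Z`, pushed in from the index domains (Hatcher
Lemma 3.27 / Prop. 2.30), each contributing `ind_p(s)` by naturality of the Kronecker pairing.
[cite: BottTu1982, Thm. 11.17] [cite: MilnorStasheff1974, §12 and §14] -/
theorem kroneckerPairing_chernClass_fundamentalClass [T2Space B] [CompactSpace B] [ParacompactSpace B]
    {n : ℕ} (hn : 2 * E.rank = n) [ChartedSpace (EuclideanSpace ℝ (Fin n)) B] (hZ : (zeroSet s).Finite)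
    (μ : HomologicalOrientation R B n) :
    kroneckerPairing R R B n (degCast R hn (E.chernClassR R E.rank)) μ.fundamentalClass =
      ∑ p ∈ hZ.toFinset, E.localIndex s hs R hE hn μ p := by
  classical
  subst hn
  rw [degCast_rfl]
  set Z : Set B := zeroSet s with hZdef
  set ŝ : C(B, E.compl.Proj) := E.complSection s hs with hŝ
  have hmaps : MapsTo ŝ Zᶜ (vectorPart E.F E.E) := mapsTo_projSection_compl_zeroSet s hs
  -- `c_k = j^* (ŝ^* t̃)`
  set x : relSingularCohomology R R B Zᶜ (2 * E.rank) :=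
    relSingularCohomology.map R R ŝ hmaps (2 * E.rank) (E.relComplThomClass R hE) with hx
  have he : E.chernClassR R E.rank = relSingularCohomology.toAbsolute R R B Zᶜ (2 * E.rank) x := by
    rw [← E.map_complSection_complThomClass R s hs hE, hx, ← ModuleCat.comp_apply,
      relSingularCohomology.map_comp_toAbsolute, ModuleCat.comp_apply, toAbsolute_relComplThomClass]
  rw [he, kroneckerPairing_toAbsolute]
  change relKroneckerM R B Zᶜ (2 * E.rank) x (singularHomology.toLocalOfSet R R B Z (2 * E.rank) μ.fundamentalClass) = _
  -- `j_*[B] ∈ H_{2k}(B | Z)` is the sum of the local orientations pushed in from the index domains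
  haveI : Fintype ↥Z := hZ.fintype
  have hUo : ∀ i : ↥Z, IsOpen (indexDomain s (i : B)) := fun i ↦ isOpen_indexDomain hZ i
  have hvU : ∀ i : ↥Z, (i : B) ∈ indexDomain s (i : B) := fun i ↦ mem_indexDomain_self s i
  have hsep : ∀ i l : ↥Z, l ≠ i → (l : B) ∉ indexDomain s (i : B) := by
    rintro i l hli (h | h)
    · exact hli (Subtype.ext h)
    · exact h l.2
  have hS : Z = ⋃ i ∈ (Finset.univ : Finset ↥Z), ({(i : B)} : Set B) := by
    ext b
    simp only [mem_iUnion, Finset.mem_univ, mem_singleton_iff, exists_prop, true_and]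
    exact ⟨fun hb ↦ ⟨⟨b, hb⟩, rfl⟩, fun ⟨i, hi⟩ ↦ hi ▸ i.2⟩
  set w : ∀ i : ↥Z, localHomology R R ↥(indexDomain s (i : B)) ⟨(i : B), hvU i⟩ (2 * E.rank) :=
    fun i ↦ (localHomology.openSubsetIso R R (hUo i) (hvU i) (2 * E.rank)).inv (μ.localClass (i : B)) with hw
  have hfc : IsFundamentalClass μ μ.fundamentalClass :=
    HomologicalOrientation.isFundamentalClass_fundamentalClass_holds (2 * E.rank) μ
  have hwi : ∀ i : ↥Z, relativeSingularHomology.map R R (subsetIncl (indexDomain s (i : B)))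
      (localHomology.mapsTo_subsetIncl_compl (hvU i)) (2 * E.rank) (w i) =
        restrictLocal R R (localHomologyOfSet.singleton_subset_of_eq_biUnion_singleton hS i) (2 * E.rank)
          (singularHomology.toLocalOfSet R R B Z (2 * E.rank) μ.fundamentalClass) := by
    intro i
    rw [singularHomology.restrictLocal_toLocalOfSet]
    change (localHomology.openSubsetIso R R (hUo i) (hvU i) (2 * E.rank)).hom (w i) =
      singularHomology.toLocal R R (i : B) (2 * E.rank) μ.fundamentalClass
    rw [hw, Iso.inv_hom_id_apply, hfc (i : B)]
  have hsum := localHomologyOfSet.eq_sum_of_forall_map_eq_restrictLocal (R := R) (M := R)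
    Subtype.val_injective hvU hsep hS (2 * E.rank) (singularHomology.toLocalOfSet R R B Z (2 * E.rank) μ.fundamentalClass) w hwi
  rw [hsum, map_sum]
  -- each term is the local index
  have hterm : ∀ i : ↥Z, relKroneckerM R B Zᶜ (2 * E.rank) x
      (relativeSingularHomology.map R R (subsetIncl (indexDomain s (i : B)))
        (localHomologyOfSet.mapsTo_subsetIncl_compl_of_forall_notMem hS hvU hsep i) (2 * E.rank) (w i)) =
      E.localIndex s hs R hE rfl μ (i : B) := by
    intro i
    rw [← relKroneckerM_map, E.localIndex_of_isOpen s hs R hE rfl μ (i : B) (hUo i), relDegCast_rfl, hx,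
      ← ModuleCat.comp_apply, ← relSingularCohomology.map_comp]
    rfl
  rw [Finset.sum_congr rfl fun i _ ↦ hterm i]
  exact (Finset.sum_subtype hZ.toFinset (fun b ↦ hZ.mem_toFinset) fun b ↦ E.localIndex s hs R hE rfl μ b).symm

/-- The same for the integral classes `chernClassZ`: **`⟨c_k(E), [B]_μ⟩ = Σ_{p ∈ Z(s)} ind_p(s)` over `ℤ`.**
[cite: BottTu1982, Thm. 11.17] [cite: MilnorStasheff1974, §12 and §14] -/
theorem kroneckerPairing_chernClassZ_fundamentalClass [T2Space B] [CompactSpace B] [ParacompactSpace B]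
    {n : ℕ} (hn : 2 * E.rank = n) [ChartedSpace (EuclideanSpace ℝ (Fin n)) B] (hZ : (zeroSet s).Finite)
    (μ : HomologicalOrientation ℤ B n) :
    kroneckerPairing ℤ ℤ B n (degCast ℤ hn (chernClassZ E E.rank)) μ.fundamentalClass =
      ∑ p ∈ hZ.toFinset, E.localIndex s hs ℤ hE hn μ p := by
  rw [chernClassZ_eq]
  exact E.kroneckerPairing_chernClass_fundamentalClass s hs ℤ hE hn hZ μ

include hs hE in
/-- **A continuous section without zeros forces `⟨c_k(E), [B]⟩ = 0`** (consistent with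
`c_k(E) = 0`, `TopChernClassSection`). [cite: MilnorStasheff1974, Property 9.7 and §14] -/
theorem kroneckerPairing_chernClass_fundamentalClass_eq_zero_of_ne_zero [T2Space B] [CompactSpace B]
    [ParacompactSpace B] {n : ℕ} (hn : 2 * E.rank = n) [ChartedSpace (EuclideanSpace ℝ (Fin n)) B]
    (hs0 : ∀ b, s b ≠ 0) (μ : HomologicalOrientation R B n) :
    kroneckerPairing R R B n (degCast R hn (E.chernClassR R E.rank)) μ.fundamentalClass = 0 := by
  have hZ : (zeroSet s).Finite := by
    rw [show zeroSet s = ∅ from eq_empty_of_forall_notMem fun b hb ↦ hs0 b hb]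
    exact finite_empty
  rw [E.kroneckerPairing_chernClass_fundamentalClass s hs R hE hn hZ μ]
  refine Finset.sum_eq_zero fun p hp ↦ ?_
  exact absurd (hZ.mem_toFinset.1 hp) (hs0 p)

end Main

end ComplexVectorBundle

end Literature.AlgebraicTopology.CharacteristicClasses

end
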